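import Summits.BirchSwinnertonDyer.Rank1Residual.Additive.X3BranchKummerLocal
import Summits.BirchSwinnertonDyer.Rank1Residual.Additive.X3BranchKummerQuotLine
import HarnessLib

/-!
# X3♯ (G-ord, `e = 2`) DEGENERATE rows — a LOWER BOUND for `#U(W[3]/Φ₀)` from Kummer classes

x3 g6, K-road part C3 (consumer: `ClassX3Gord.bsdp_three_rankZero_degenerate_of_facts_of_torsionFact_of_cardGe`
in `X3BranchDegenerateEndStateCardGe.lean`, hypothesis `hnge`).  For the TRIVIAL rational line
`Φ₀ ≤ W[3]` the quotient `Ψ = W[3]/Φ₀` is `μ₃` (`KummerLineClasses.quot_smul_eq_cyclotomic_of_trivialLine`),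
and GV's `U(Ψ) ⊂ H¹(ℚ_Σ/ℚ_∞, Ψ)` (classes unramified at `3`, `residualQuotSelmer`) contains the
restrictions of the Kummer classes of rational `Σ₀`-units that are cubes in `ℚ₃`.  This file
assembles the pieces of `X3BranchKummerLineClasses.lean`, `X3BranchKummerLocal.lean`,
`X3BranchKummerQuotLine.lean` into the counting statement
`X3Branch.pow_card_le_natCard_residualQuotSelmer_of_trivialLine : 3^{#ι} ≤ #U`
for a family `(a_i)_{i ∈ ι}` of such units with independent prime supports (certificates:
`ℓ_i ∥ a_i`, `ℓ_i ∤ a_j`, `27 ∣ c_i³ − a_i`, `3 ∤ c_i`).  No named fact, no instrument.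
-/

set_option autoImplicit false

noncomputable section

open scoped Classical AddSubgroup

namespace Summit.BirchSwinnertonDyer.Rank1Residual.Additive

open NumberField IsDedekindDomain Field WeierstrassCurve
  Literature.NumberTheory.GaloisRepresentations
  Literature.NumberTheory.EllipticCurves
  Literature.NumberTheory.EllipticCurves.GreenbergSelmer
  Literature.NumberTheory.EllipticCurves.GreenbergVatsal2000
  Literature.NumberTheory.EllipticCurves.Rank1Residual
  Summit.BirchSwinnertonDyer.Rank1Residual.X2.ResidualDevissageModules
  Summit.BirchSwinnertonDyer.Rank1Residual.X2.ResidualDevissageLine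
  KummerLineClasses

variable {W : WeierstrassCurve ℚ} [W.IsElliptic]

/-- **LOWER BOUND for GV's `U(W[3]/Φ₀)` on the DEGENERATE rows from EXHIBITED Kummer classes.**
`κ` any `ℤ₃`-extension (`G_{ℚ_κ} = ker κ`), `Σ₀` finite, `Φ₀ ≤ W[3]` a rational line fixed pointwise by `Γ_ℚ`
(so that `Ψ = W[3]/Φ₀ ≅ μ₃` by the Weil pairing). DATA: natural numbers `a_i` (`i ∈ ι`), each
divisible exactly once by a prime `ℓ_i` and not by the other `ℓ_j`, all of whose
prime factors lie under `Σ₀`, each a CUBE in `ℚ₃` by a certificate `3 ∤ c_i`, `27 ∣ c_i³ − a_i`.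
THEN `3^{#ι} ≤ #U` (`residualQuotSelmer`, assumed finite): the Kummer classes of the `a_i`
(restricted to `G_{ℚ_∞}`) lie in `U` — unramified at `v ∉ Σ₀ ∪ {3}` since `I_v` fixes the cube roots,
unramified at `3` since a cube root is fixed by `D_3` — and `k ↦ Σ k_i [a_i]`, `k ∈ 𝔽₃^ι`, injects:
a class vanishing on `G_{ℚ_∞}` makes `∏ a_i^{k_i}` a cube in `ℚ` (`exists_ratCast_eq_of_fixed`),
impossible unless `k = 0` (`ℓ_i`-adic valuations). This is the `#Σ₀ − 1` share of the count
`#U(μ₃) = 3^{Σ s_ℓ − 1}` (x3-MEMO-2 D3) on the sub-locus `ℓ ≢ ±1 (mod 9)`.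
[cite: GreenbergVatsal2000, §2 pp. 28–29] [cite: SerreLocalFields1979, Ch. X §3]
[cite: Cassels1986, Ch. 4 Lemma 3.1] -/
theorem X3Branch.pow_card_le_natCard_residualQuotSelmer_of_trivialLine [hp : Fact (Nat.Prime 3)]
    (κ : ZpExtension ℚ 3) (S₀ : Finset (HeightOneSpectrum (𝓞 ℚ)))
    {Φ₀ : AddSubgroup (W.geomTorsion ((3 : ℕ) : ℤ))} (hΦ : IsRationalLine W 3 Φ₀)
    (htriv : ∀ (σ : absoluteGaloisGroup ℚ) (P : geomTorsion W ((3 : ℕ) : ℤ)), P ∈ Φ₀ → σ • P = P)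
    {ι : Type} [Fintype ι] (a ℓ : ι → ℕ) (c : ι → ℤ) (ha : ∀ i, a i ≠ 0)
    (hℓ : ∀ i, (ℓ i).Prime)
    (hval : ∀ i j, padicValNat (ℓ i) (a j) = if i = j then 1 else 0)
    (haS : ∀ i (v : HeightOneSpectrum (𝓞 ℚ)), ((a i : ℕ) : 𝓞 ℚ) ∈ v.asIdeal → v ∈ S₀)
    (hc : ∀ i, ¬ (3 : ℤ) ∣ c i) (hcert : ∀ i, (27 : ℤ) ∣ c i ^ 3 - a i)
    [Finite (residualQuotSelmer W 3 κ S₀ Φ₀ hΦ)] :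
    3 ^ Fintype.card ι ≤ Nat.card (residualQuotSelmer W 3 κ S₀ Φ₀ hΦ) := by
  haveI : NeZero ((3 : ℕ) : ℚ) := ⟨by norm_num⟩
  -- the `ω`-line `Ψ = W[3]/Φ₀` with a generator `y₀`
  have hΨ := quot_smul_eq_cyclotomic_of_trivialLine (p := 3) hΦ htriv
  obtain ⟨y₀, hy₀, hgen⟩ := exists_generator_quot (p := 3) hΦ
  have hy₀3 : 3 • y₀ = 0 := by
    have h := addOrderOf_nsmul_eq_zero y₀
    rwa [hy₀] at h
  -- a primitive cube root of unity and the place above `3`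
  obtain ⟨ζ, hζ⟩ := HasEnoughRootsOfUnity.exists_primitiveRoot (AlgebraicClosure ℚ) 3
  set v₃ : HeightOneSpectrum (𝓞 ℚ) := Rat.HeightOneSpectrum.primesEquiv.symm ⟨3, hp.out⟩ with hv₃
  have hv₃3 : ((3 : ℕ) : 𝓞 ℚ) ∈ v₃.asIdeal :=
    (Literature.NumberTheory.Automorphic.BCDT.natCast_mem_asIdeal_iff_primesEquiv_eq v₃ hp.out).mpr
      (by rw [hv₃, Equiv.apply_symm_apply])
  have huniq3 : ∀ v : HeightOneSpectrum (𝓞 ℚ), ((3 : ℕ) : 𝓞 ℚ) ∈ v.asIdeal → v = v₃ := fun v hv ↦ by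
    have h1 := (Literature.NumberTheory.Automorphic.BCDT.natCast_mem_asIdeal_iff_primesEquiv_eq v hp.out).mp hv
    have h2 := (Literature.NumberTheory.Automorphic.BCDT.natCast_mem_asIdeal_iff_primesEquiv_eq v₃ hp.out).mp hv₃3
    exact Rat.HeightOneSpectrum.primesEquiv.injective (Subtype.ext (h1.trans h2.symm))
  -- the cube roots `β_i`, fixed by `D_3`
  choose β hβ hβD using fun i ↦ exists_root_smul_eq_self_of_cube_cert hζ v₃ hv₃3
    (a := (a i : ℤ)) (by exact_mod_cast ha i) (hc i) (hcert i)
  have hβ' : ∀ i, β i ^ 3 = ((a i : ℚ) : AlgebraicClosure ℚ) := fun i ↦ by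
    rw [hβ i]; push_cast; rfl
  -- the Kummer cocycles `f_i`
  choose f hfc hfcoc hfrel using fun i ↦ exists_kummerCocycle (p := 3) hΨ y₀ hy₀3 hζ
    (a := (a i : ℚ)) (by exact_mod_cast ha i) (hβ' i)
  have hβ0 : ∀ i, β i ≠ 0 := fun i h ↦ by
    have := hβ' i
    rw [h, zero_pow (by norm_num)] at this
    exact (ha i) (by exact_mod_cast this.symm)
  -- `f_i` vanishes where the root is fixed
  have hfix0 : ∀ i σ, σ • β i = β i → f i σ = 0 := by
    intro i σ hσ
    obtain ⟨n, hn, hfn⟩ := hfrel i σ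
    rw [hσ] at hn
    have hζn : ζ ^ n = 1 := by
      have h1 : ζ ^ n * β i = 1 * β i := by rw [one_mul]; exact hn.symm
      exact mul_right_cancel₀ (hβ0 i) h1
    obtain ⟨m, rfl⟩ := (hζ.pow_eq_one_iff_dvd n).mp hζn
    rw [hfn, mul_nsmul, hy₀3, nsmul_zero]
  have hfI : ∀ i (v : HeightOneSpectrum (𝓞 ℚ)), v ∉ S₀ → ∀ τ ∈ inertia v, f i τ = 0 := by
    intro i v hvS τ hτ
    apply hfix0
    by_cases hv3 : ((3 : ℕ) : 𝓞 ℚ) ∈ v.asIdeal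
    · rw [huniq3 v hv3] at hτ
      exact hβD i τ (inertia_le_decomp v₃ hτ)
    · exact smul_eq_self_of_mem_inertia_of_pow_eq (p := 3) hζ (ha i)
        (by rw [hβ' i, Rat.cast_natCast]) hv3 (fun h ↦ hvS (haS i v h)) hτ
  have hfI3 : ∀ i (v : HeightOneSpectrum (𝓞 ℚ)), ((3 : ℕ) : 𝓞 ℚ) ∈ v.asIdeal →
      ∀ τ ∈ inertia v, f i τ = 0 := by
    intro i v hv3 τ hτ
    apply hfix0
    rw [huniq3 v hv3] at hτ
    exact hβD i τ (inertia_le_decomp v₃ hτ)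
  -- `3`-torsion bookkeeping in `Ψ`
  have h3Ψ : ∀ y : (lineSub Φ₀ hΦ).Quot, 3 • y = 0 := fun y ↦ by
    obtain ⟨t, rfl⟩ := hgen y
    rw [← mul_nsmul, mul_comm, mul_nsmul, hy₀3, nsmul_zero]
  have hmodΨ : ∀ (y : (lineSub Φ₀ hΦ).Quot) (n m : ℕ), (n : ZMod 3) = m → n • y = m • y :=
    fun y n m h ↦ by
      rw [nsmul_eq_mod_nsmul n (h3Ψ y), nsmul_eq_mod_nsmul m (h3Ψ y),
        (ZMod.natCast_eq_natCast_iff' n m 3).mp h]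
  have hsubΨ : ∀ (y : (lineSub Φ₀ hΦ).Quot) (k k' : ZMod 3),
      k.val • y - k'.val • y = (k - k').val • y := fun y k k' ↦ by
    rw [sub_eq_iff_eq_add, ← add_nsmul]
    apply hmodΨ
    push_cast
    simp only [ZMod.natCast_val, ZMod.cast_id', id_eq, sub_add_cancel]
  -- the combinations `F k = Σ k_i f_i`
  set F : (ι → ZMod 3) → absoluteGaloisGroup ℚ → (lineSub Φ₀ hΦ).Quot :=
    fun k σ ↦ ∑ i, (k i).val • f i σ with hFdef
  haveI : ContinuousAdd (lineSub Φ₀ hΦ).Quot := ⟨continuous_of_discreteTopology⟩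
  have hFc : ∀ k, Continuous (F k) := fun k ↦
    continuous_finsetSum _ fun i _ ↦ (continuous_nsmul (k i).val).comp (hfc i)
  have hFcoc : ∀ k σ τ, F k (σ * τ) = F k σ + σ • F k τ := fun k σ τ ↦ by
    simp only [hFdef, hfcoc, nsmul_add, Finset.sum_add_distrib, Finset.smul_sum, smul_comm σ]
  have hFrel : ∀ k σ, ∃ n : ℕ, σ • (∏ i, β i ^ (k i).val) = ζ ^ n * ∏ i, β i ^ (k i).val ∧
      F k σ = n • y₀ := fun k σ ↦ rel_sum Finset.univ y₀ β f hfrel (fun i ↦ (k i).val) σ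
  have hFsub : ∀ k k' σ, F k σ - F k' σ = F (k - k') σ := fun k k' σ ↦ by
    simp only [hFdef, ← Finset.sum_sub_distrib, hsubΨ, Pi.sub_apply]
  have hFI : ∀ k (v : HeightOneSpectrum (𝓞 ℚ)), v ∉ (↑S₀ : Set (HeightOneSpectrum (𝓞 ℚ))) →
      ∀ τ ∈ inertia v, F k τ = 0 := fun k v hvS τ hτ ↦ by
    simp only [hFdef]
    exact Finset.sum_eq_zero fun i _ ↦ by rw [hfI i v hvS τ hτ, nsmul_zero]
  have hFI3 : ∀ k (v : HeightOneSpectrum (𝓞 ℚ)), ((3 : ℕ) : 𝓞 ℚ) ∈ v.asIdeal →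
      ∀ τ ∈ inertia v, F k τ = 0 := fun k v hv τ hτ ↦ by
    simp only [hFdef]
    exact Finset.sum_eq_zero fun i _ ↦ by rw [hfI3 i v hv τ hτ, nsmul_zero]
  -- the classes `c k = [F k|_{G_{ℚ_∞}}] ∈ U`
  choose Fc cls hFc1 hcls using fun k ↦
    exists_class_of_cocycle κ.kerSubgroup (F k) (hFc k) (hFcoc k)
  have hmem : ∀ k, cls k ∈ unramifiedSelmer κ.kerSubgroup (lineSub Φ₀ hΦ).Quot 3
      (↑S₀ : Set (HeightOneSpectrum (𝓞 ℚ))) := fun k ↦ by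
    rw [hcls k]
    exact mem_unramifiedSelmer_of_cocycle κ.kerSubgroup (F k) (hFcoc k) (Fc k) (hFc1 k) _
      (hFI k) (hFI3 k)
  -- injectivity: a class vanishing on `G_{ℚ_∞}` makes `∏ a_i^{k_i}` a cube in `ℚ`
  have hzero : ∀ d : ι → ZMod 3, cls d = 0 → d = 0 := by
    intro d hd
    rw [hcls d, oneCocycleClass_eq_zero_iff] at hd
    obtain ⟨y, hy⟩ := hd
    have hcob : ∀ h ∈ κ.kerSubgroup, F d h = h • y - y := fun h hh ↦ by
      have := hy ⟨h, hh⟩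
      rw [hFc1 d ⟨h, hh⟩] at this
      exact this
    set A : ℚ := ∏ i, (a i : ℚ) ^ (d i).val with hA
    have hA0 : A ≠ 0 := Finset.prod_ne_zero_iff.mpr fun i _ ↦ pow_ne_zero _ (by exact_mod_cast ha i)
    have hB : (∏ i, β i ^ (d i).val) ^ 3 = (A : AlgebraicClosure ℚ) := by
      rw [← Finset.prod_pow, hA]
      push_cast
      refine Finset.prod_congr rfl fun i _ ↦ ?_
      rw [← pow_mul, mul_comm, pow_mul, hβ' i, Rat.cast_natCast]
    obtain ⟨γ, hγ, hγfix⟩ := exists_fixed_root_of_coboundary (p := 3) hΨ hy₀ hgen hζ hB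
      (hFrel d) κ.kerSubgroup hcob
    obtain ⟨r, hr⟩ := exists_ratCast_eq_of_fixed (p := 3) (by decide) κ hζ hA0 hγ hγfix
    refine eq_zero_of_pow_eq_prod (p := 3) a ℓ hℓ hval ha d r ?_
    have h3 : ((r ^ 3 : ℚ) : AlgebraicClosure ℚ) = (A : AlgebraicClosure ℚ) := by
      rw [Rat.cast_pow, hr, hγ]
    have h3' : r ^ 3 = A := by exact_mod_cast h3
    rw [hA] at h3'
    exact h3'
  -- counting
  haveI hfin : Finite (unramifiedSelmer κ.kerSubgroup (lineSub Φ₀ hΦ).Quot 3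
      (↑S₀ : Set (HeightOneSpectrum (𝓞 ℚ)))) := ‹Finite (residualQuotSelmer W 3 κ S₀ Φ₀ hΦ)›
  let Fmap : (ι → ZMod 3) → unramifiedSelmer κ.kerSubgroup (lineSub Φ₀ hΦ).Quot 3
      (↑S₀ : Set (HeightOneSpectrum (𝓞 ℚ))) := fun k ↦ ⟨cls k, hmem k⟩
  have hinj : Function.Injective Fmap := by
    intro k k' hkk'
    have h1 : cls k = cls k' := congrArg Subtype.val hkk'
    have h2 : cls (k - k') = 0 := by
      have e : Fc k - Fc k' = Fc (k - k') := by
        apply Subtype.ext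
        ext h
        change (Fc k).1 h - (Fc k').1 h = (Fc (k - k')).1 h
        rw [hFc1, hFc1, hFc1, hFsub]
      rw [hcls, ← e, oneCocycleClass_sub, ← hcls, ← hcls, h1, sub_self]
    exact sub_eq_zero.mp (hzero _ h2)
  have hcard := Nat.card_le_card_of_injective Fmap hinj
  rw [Nat.card_fun, Nat.card_zmod, Nat.card_eq_fintype_card] at hcard
  exact hcard

end Summit.BirchSwinnertonDyer.Rank1Residual.Additive
end
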